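import Literature.NumberTheory.Rogawski1990.ArchCentralLimitAngleChart   -- ★ p842695 + ED. 2 p842935 (F0P3a-p03 (g11)): `tendsto_nhdsWithin_injective_of_forall_chamber` (letter ⇔ six chamber limits)
import Literature.NumberTheory.Rogawski1990.ArchCentralLimitFormula      -- ★ p842205 (F0P3a-p02 (g11)): the (L_{U(2,1)}) letter `ArchCentralLimitFormulaRankTwo`
import Literature.NumberTheory.Automorphic.ArchLocalRegularOrbitClosed     -- ★ `locallyCompactSpace_archLocal`, `secondCountableTopology_archLocal` (the letter's topological instance binders)
import Mathlib.Analysis.Calculus.ContDiff.Basic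
import Mathlib.Analysis.Calculus.IteratedDeriv.Lemmas
import HarnessLib

/-!
# The N1 ASSEMBLY SKELETON: the (L_{U(2,1)}) letter from `C³` CORNER EXTENSIONS of `F_Θ = ρ′Δ·Φ_Θ` on each of the six Weyl chambers
# (Rogawski 1990 §8.4 p. 126 «`ω[ρ(γ)′Δ(γ)Φ_G(γ,f)]` is continuous at `γ₀`»; Harish-Chandra [H₂] Lemma 17.5 — ROAD A step (A4)∕(A6))

Topic `NumberTheory/Rogawski1990`; namespace `Literature.NumberTheory.Rogawski1990` (§1 generic line-jet calculus in `Literature.Analysis.Calculus`).  THEOREMS ONLY (no `def`, no instance,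
no notation, no axiom, no named fact, no `sorry`).  Cell `pub/hodgecm-mathlib`, ENGINE T1 (crux H413 = `stmt-HodgeConjecture-24833`); ROAD-Sd, «SdArch» ED. 3's ONE open stub N1 =
`stub_ArchCentralLimitU21 : ∀ L α w, ArchCentralLimitFormulaRankTwo L α w` (★ p842205; ROAD A, owner F0P3a-p05); the N1 ASSEMBLY SKELETON (α1) dealt to F0P3a-p02 (g12) by LEAD F0P3a-plan (g10)
WORD T9-8 (D); census `CENSUS-A4-N1AssemblySkeleton.F0P3a-p02g12.md` a4f70f9f §1 FILE B (FILE A = ★ p842935, F0P3a-p03 (g11), by head).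

THE REDUCTION (sorry-free; what ROAD A must deliver becomes a HYPOTHESIS).  In the angle chart `θ ↦ ζe^{iθ}` at the centre the regular set is the union of six open convex cones
`C_σ = {θ | θ(σ0) < θ(σ1) < θ(σ2)}` and the letter ⇔ the same limit of `Λ₈[F_Θ]` from each chamber (★ p842935).  ONE CHAMBER (§3, generic in the torus function `Fz`):
if `F := Fz ∘ chart` agrees on `U ∩ C_σ` (`U` an open neighbourhood of the corner `θ = 0`) with a function `H` that is `C³` ON `U` — a `C³` EXTENSION OF `F|_{C_σ}` TO THE CORNER — then the
letter's 8-ray functional `Λ₈[Fz](ζe^{iθ}) = (1∕48) Σ_ε s₀s₁s₂ (d∕ds)³|₀ Fz(ζe^{iθ}·e^{isv_ε})` tends, as `θ → 0` inside `C_σ`, to `Λ₈^∠[H](0) = (1∕48) Σ_ε s₀s₁s₂ (d∕ds)³|₀ H(s·v_ε)`: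
at a chamber point the rays stay in `U ∩ C_σ` for small `s`, so the ray jets of `F` ARE the line jets of `H` (`Filter.EventuallyEq.iteratedDeriv_eq`), and `θ ↦ (d∕ds)³|₀ H(s·v + θ) = D³H(θ)[v,v,v]`
is continuous at the corner (§1, `ContDiffOn` on an open set, Mathlib `ContinuousLinearMap.iteratedFDerivWithin_comp_right` + `ContDiffAt.continuousAt_iteratedFDeriv`).  THE LETTER (§4):
**`ArchCentralLimitFormulaRankTwo.of_chamberExtensions`** — if for every Haar right-invariant `ν` there is `c > 0` such that for every ambient smooth `Θ` compactly supported on `G_w`, every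
central `ζ` and EVERY chamber `σ` such a corner extension `H` of `F_Θ = ρ′Δ·Φ_Θ` (in the letter's tokens) exists WITH `Λ₈^∠[H](0) = −(c·i)·Θ(diag(ζ,ζ,ζ))`, then ★ `ArchCentralLimitFormulaRankTwo L α w`
holds — the frame guards and instance binders of the `def` are passed through untouched (`locallyCompactSpace_archLocal`, `secondCountableTopology_archLocal` supplied).
WHAT THIS MAKES VISIBLE (census a4f70f9f §2, «(A6)»): ROAD A as mapped ((A1′)(A2″)(A3)(A5)) computes `lim ωF_Θ` ALONG THE COMPACT WALL; the letter needs the limit THROUGH each open chamber, i.e.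
exactly the hypothesis here — `F_Θ|_{C_σ}` is `C³` up to the corner (Harish-Chandra's boundary regularity of the invariant integral at a non-semiregular point) — plus the common value.
HONEST LABEL: HC_CM is proved only modulo the printed citations until rung 0 closes; this file is a REDUCTION of the printed-hard letter N1 and pays nothing by itself.

## References
* [Rogawski1990] J. D. Rogawski, *Automorphic Representations of Unitary Groups in Three Variables*, Ann. of Math. Stud. 123 (1990), §8.4 pp. 126–127.
* [Varadarajan1989] V. S. Varadarajan, *An Introduction to Harmonic Analysis on Semisimple Lie Groups* (1989), §6.4 (limit formulas; regularity of `F_f` up to the walls, rank one).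
* [HormanderALPDO1] L. Hörmander, *The Analysis of Linear Partial Differential Operators I*, 2nd ed. (1990), Thm. 1.1.9 (chain rule for jets along lines).
-/

set_option autoImplicit false

noncomputable section

open MeasureTheory Measure Filter Topology Set Function NumberField NumberField.InfinitePlace
open scoped ContDiff

/-! ## §1 Line jets of a function that is `Cⁿ` on an OPEN set: `(d∕ds)ᵏ|_t f(s·u + x) = Dᵏf(t·u + x)[u,…,u]`, continuous in the base point -/

namespace Literature.Analysis.Calculus

variable {E F : Type*} [NormedAddCommGroup E] [NormedSpace ℝ E] [NormedAddCommGroup F] [NormedSpace ℝ F]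

/-- **Line jets, finite order, local**: for `f` of class `Cⁿ` on the OPEN set `U`, `k ≤ n` and `t·u + x ∈ U`, `(d∕ds)ᵏ|_{s=t} f(s·u + x) = Dᵏf(t·u + x)[u, …, u]` (the finite-order, translated twin of
★ `AnalyticOfFDerivBound.iteratedDeriv_comp_line`; Mathlib `ContinuousLinearMap.iteratedFDerivWithin_comp_right` on the open preimage). [cite: HormanderALPDO1, Thm. 1.1.9] -/
theorem iteratedDeriv_line_eq_iteratedFDeriv_of_contDiffOn {f : E → F} {U : Set E} (hU : IsOpen U) {n : ℕ} (hf : ContDiffOn ℝ n f U) (u x : E) {t : ℝ} (ht : t • u + x ∈ U)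
    {k : ℕ} (hk : k ≤ n) :
    iteratedDeriv k (fun s : ℝ => f (s • u + x)) t = iteratedFDeriv ℝ k f (t • u + x) fun _ => u := by
  set L : ℝ →L[ℝ] E := ContinuousLinearMap.toSpanSingleton ℝ u with hL
  have hLapply : ∀ s : ℝ, L s = s • u := fun s => ContinuousLinearMap.toSpanSingleton_apply ℝ u s
  set f₁ : E → F := fun z => f (z + x) with hf₁
  set U₁ : Set E := (fun z => z + x) ⁻¹' U with hU₁
  have hU₁o : IsOpen U₁ := hU.preimage (by fun_prop)
  have hf₁U : ContDiffOn ℝ n f₁ U₁ := hf.comp (contDiff_id.add contDiff_const).contDiffOn fun z hz => hz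
  have hLU : IsOpen (L ⁻¹' U₁) := hU₁o.preimage L.continuous
  have htL : L t ∈ U₁ := by
    show L t + x ∈ U
    rwa [hLapply]
  have hcomp : f₁ ∘ L = fun s : ℝ => f (s • u + x) := by
    funext s
    simp [hf₁, hLapply]
  have h1 := ContinuousLinearMap.iteratedFDerivWithin_comp_right L hf₁U hU₁o.uniqueDiffOn hLU.uniqueDiffOn htL (i := k) (by exact_mod_cast hk)
  rw [iteratedFDerivWithin_of_isOpen k hLU (by exact htL), iteratedFDerivWithin_of_isOpen k hU₁o htL, hcomp] at h1
  rw [iteratedDeriv_eq_iteratedFDeriv, h1, ContinuousMultilinearMap.compContinuousLinearMap_apply, hf₁, iteratedFDeriv_comp_add_right, hLapply]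
  simp [hLapply]

/-- **Line jets at `s = 0` are continuous in the base point**: for `f` of class `Cⁿ` on the open `U ∋ x` and `k ≤ n`, `y ↦ (d∕ds)ᵏ|₀ f(s·u + y)` is continuous at `x` (it is `y ↦ Dᵏf(y)[u,…,u]` near `x`,
Mathlib `ContDiffAt.continuousAt_iteratedFDeriv`). [cite: HormanderALPDO1, Thm. 1.1.9] -/
theorem continuousAt_iteratedDeriv_line_of_contDiffOn {f : E → F} {U : Set E} (hU : IsOpen U) {n : ℕ} (hf : ContDiffOn ℝ n f U) (u : E) {x : E} (hx : x ∈ U) {k : ℕ} (hk : k ≤ n) :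
    ContinuousAt (fun y : E => iteratedDeriv k (fun s : ℝ => f (s • u + y)) 0) x := by
  have hev : (fun y : E => iteratedFDeriv ℝ k f y fun _ => u) =ᶠ[𝓝 x] fun y : E => iteratedDeriv k (fun s : ℝ => f (s • u + y)) 0 := by
    filter_upwards [hU.mem_nhds hx] with y hy
    have h := iteratedDeriv_line_eq_iteratedFDeriv_of_contDiffOn hU hf u y (t := 0) (by simpa using hy) hk
    simp only [zero_smul, zero_add] at h
    exact h.symm
  refine ContinuousAt.congr ?_ hev
  have hc : ContinuousAt (iteratedFDeriv ℝ k f) x := (hf.contDiffAt (hU.mem_nhds hx)).continuousAt_iteratedFDeriv (by exact_mod_cast hk)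
  have heval : Continuous fun m : ContinuousMultilinearMap ℝ (fun _ : Fin k => E) F => m (fun _ => u) :=
    (ContinuousMultilinearMap.apply ℝ (fun _ : Fin k => E) F (fun _ => u)).continuous
  exact heval.continuousAt.comp hc

end Literature.Analysis.Calculus

namespace Literature.NumberTheory.Rogawski1990

open Literature.Analysis.Calculus Literature.NumberTheory.Automorphic Literature.NumberTheory.Automorphic.UnitaryGroup
open scoped Matrix MatrixGroups Matrix.Norms.Operator

/-! ## §2 The chambers are open (the rays of the 8-ray functional at a chamber point stay inside) -/

section Chamber

/-- Each chamber `C_σ = {θ | θ(σ0) < θ(σ1) < θ(σ2)}` is OPEN in angle space. [cite: Rogawski1990, §8.4 p. 126] -/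
theorem isOpen_chamber (σ : Equiv.Perm (Fin 3)) : IsOpen {θ : Fin 3 → ℝ | θ (σ 0) < θ (σ 1) ∧ θ (σ 1) < θ (σ 2)} :=
  (isOpen_lt (continuous_apply (σ 0)) (continuous_apply (σ 1))).and (isOpen_lt (continuous_apply (σ 1)) (continuous_apply (σ 2)))

/-- The angle chart along a ray: `ζe^{iθ_k}·e^{is u_k} = ζe^{i(s·u + θ)_k}` (the ray of the 8-ray functional at `ζe^{iθ}` in direction `u` is the chart of the LINE `s ↦ s·u + θ`).
[cite: Rogawski1990, §8.4 p. 126] -/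
theorem angleChart_mul_exp_ray (ζ : Circle) (u θ : Fin 3 → ℝ) (s : ℝ) (k : Fin 3) :
    ζ * Circle.exp (θ k) * Circle.exp (s * u k) = ζ * Circle.exp ((s • u + θ) k) := by
  rw [mul_assoc, ← Circle.exp_add]
  congr 2
  simp only [Pi.add_apply, Pi.smul_apply, smul_eq_mul]
  ring

end Chamber

/-! ## §3 ONE CHAMBER: a `C³` corner extension of `F ∘ chart` on `C_σ` gives the chamber limit of the 8-ray functional, for ANY torus function `Fz` -/

section OneChamber

/-- **(B-1) ONE CHAMBER, ANY TORUS FUNCTION.**  Let `Fz : (S¹)³ → ℂ`, `ζ ∈ S¹`, a chamber `C_σ`, an OPEN `U ∋ 0` of angle space and `H : ℝ³ → ℂ` of class `C³` ON `U` with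
`H(θ) = Fz(ζe^{iθ})` for `θ ∈ U ∩ C_σ` (a `C³` EXTENSION TO THE CORNER of `Fz ∘ chart|_{C_σ}`).  Then the letter's 8-ray functional of `Fz`, read at `ζe^{iθ}`,
`(1∕48) Σ_ε s₀s₁s₂ · (d∕ds)³|₀ Fz((ζe^{iθ_k}e^{is(v_ε)_k})_k)`, tends as `θ → 0` WITHIN `C_σ` to `Λ₈^∠[H](0) = (1∕48) Σ_ε s₀s₁s₂ · (d∕ds)³|₀ H(s·v_ε)`: at a chamber point of `U` every ray
`s ↦ s·v_ε + θ` stays in `U ∩ C_σ` for small `s` (both open), so the ray jet of `Fz ∘ chart` IS the line jet of `H` (`Filter.EventuallyEq.iteratedDeriv_eq`), and the line jets of `H` are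
continuous at the corner (§1). [cite: Rogawski1990, §8.4 p. 126] [cite: Varadarajan1989, §6.4] -/
theorem tendsto_lambda8_angleChart_nhdsWithin_chamber_of_contDiffOn (Fz : (Fin 3 → Circle) → ℂ) (ζ : Circle) (σ : Equiv.Perm (Fin 3))
    {U : Set (Fin 3 → ℝ)} (hUo : IsOpen U) (h0U : (0 : Fin 3 → ℝ) ∈ U) {H : (Fin 3 → ℝ) → ℂ} (hH : ContDiffOn ℝ 3 H U)
    (hHF : ∀ θ ∈ U, θ (σ 0) < θ (σ 1) ∧ θ (σ 1) < θ (σ 2) → H θ = Fz (fun k : Fin 3 => ζ * Circle.exp (θ k))) :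
    Tendsto (fun θ : Fin 3 → ℝ =>
        (1 / 48 : ℂ) * ∑ ε : Fin 3 → Bool, ((((if ε 0 then (1 : ℝ) else -1) * (if ε 1 then (1 : ℝ) else -1) * (if ε 2 then (1 : ℝ) else -1) : ℝ)) : ℂ) *
          iteratedDeriv 3 (fun s : ℝ => Fz (fun k => ζ * Circle.exp (θ k) * Circle.exp (s * (![(if ε 0 then (1 : ℝ) else -1) + (if ε 1 then (1 : ℝ) else -1), -(if ε 0 then (1 : ℝ) else -1) + (if ε 2 then (1 : ℝ) else -1), -(if ε 1 then (1 : ℝ) else -1) - (if ε 2 then (1 : ℝ) else -1)] k)))) 0)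
      (𝓝[{θ : Fin 3 → ℝ | θ (σ 0) < θ (σ 1) ∧ θ (σ 1) < θ (σ 2)}] 0)
      (𝓝 ((1 / 48 : ℂ) * ∑ ε : Fin 3 → Bool, ((((if ε 0 then (1 : ℝ) else -1) * (if ε 1 then (1 : ℝ) else -1) * (if ε 2 then (1 : ℝ) else -1) : ℝ)) : ℂ) *
          iteratedDeriv 3 (fun s : ℝ => H (s • ![(if ε 0 then (1 : ℝ) else -1) + (if ε 1 then (1 : ℝ) else -1), -(if ε 0 then (1 : ℝ) else -1) + (if ε 2 then (1 : ℝ) else -1), -(if ε 1 then (1 : ℝ) else -1) - (if ε 2 then (1 : ℝ) else -1)])) 0)) := by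
  -- §A the line jets of `H` are continuous at the corner
  have hT : ∀ u : Fin 3 → ℝ, Tendsto (fun θ : Fin 3 → ℝ => iteratedDeriv 3 (fun s : ℝ => H (s • u + θ)) 0) (𝓝 0)
      (𝓝 (iteratedDeriv 3 (fun s : ℝ => H (s • u)) 0)) := fun u => by
    have h := (continuousAt_iteratedDeriv_line_of_contDiffOn hUo hH u h0U le_rfl).tendsto
    simpa only [add_zero] using h
  have hG : Tendsto (fun θ : Fin 3 → ℝ =>
        (1 / 48 : ℂ) * ∑ ε : Fin 3 → Bool, ((((if ε 0 then (1 : ℝ) else -1) * (if ε 1 then (1 : ℝ) else -1) * (if ε 2 then (1 : ℝ) else -1) : ℝ)) : ℂ) *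
          iteratedDeriv 3 (fun s : ℝ => H (s • ![(if ε 0 then (1 : ℝ) else -1) + (if ε 1 then (1 : ℝ) else -1), -(if ε 0 then (1 : ℝ) else -1) + (if ε 2 then (1 : ℝ) else -1), -(if ε 1 then (1 : ℝ) else -1) - (if ε 2 then (1 : ℝ) else -1)] + θ)) 0)
      (𝓝 0) (𝓝 ((1 / 48 : ℂ) * ∑ ε : Fin 3 → Bool, ((((if ε 0 then (1 : ℝ) else -1) * (if ε 1 then (1 : ℝ) else -1) * (if ε 2 then (1 : ℝ) else -1) : ℝ)) : ℂ) *
          iteratedDeriv 3 (fun s : ℝ => H (s • ![(if ε 0 then (1 : ℝ) else -1) + (if ε 1 then (1 : ℝ) else -1), -(if ε 0 then (1 : ℝ) else -1) + (if ε 2 then (1 : ℝ) else -1), -(if ε 1 then (1 : ℝ) else -1) - (if ε 2 then (1 : ℝ) else -1)])) 0)) :=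
    tendsto_const_nhds.mul (tendsto_finsetSum _ fun ε _ => tendsto_const_nhds.mul (hT _))
  -- §B inside the chamber, near the corner, the 8-ray functional of `Fz ∘ chart` IS `Λ₈^∠[H]`
  have hEq : (fun θ : Fin 3 → ℝ =>
        (1 / 48 : ℂ) * ∑ ε : Fin 3 → Bool, ((((if ε 0 then (1 : ℝ) else -1) * (if ε 1 then (1 : ℝ) else -1) * (if ε 2 then (1 : ℝ) else -1) : ℝ)) : ℂ) *
          iteratedDeriv 3 (fun s : ℝ => H (s • ![(if ε 0 then (1 : ℝ) else -1) + (if ε 1 then (1 : ℝ) else -1), -(if ε 0 then (1 : ℝ) else -1) + (if ε 2 then (1 : ℝ) else -1), -(if ε 1 then (1 : ℝ) else -1) - (if ε 2 then (1 : ℝ) else -1)] + θ)) 0) =ᶠ[𝓝[{θ : Fin 3 → ℝ | θ (σ 0) < θ (σ 1) ∧ θ (σ 1) < θ (σ 2)}] 0]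
      (fun θ : Fin 3 → ℝ =>
        (1 / 48 : ℂ) * ∑ ε : Fin 3 → Bool, ((((if ε 0 then (1 : ℝ) else -1) * (if ε 1 then (1 : ℝ) else -1) * (if ε 2 then (1 : ℝ) else -1) : ℝ)) : ℂ) *
          iteratedDeriv 3 (fun s : ℝ => Fz (fun k => ζ * Circle.exp (θ k) * Circle.exp (s * (![(if ε 0 then (1 : ℝ) else -1) + (if ε 1 then (1 : ℝ) else -1), -(if ε 0 then (1 : ℝ) else -1) + (if ε 2 then (1 : ℝ) else -1), -(if ε 1 then (1 : ℝ) else -1) - (if ε 2 then (1 : ℝ) else -1)] k)))) 0) := by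
    filter_upwards [inter_mem_nhdsWithin {θ : Fin 3 → ℝ | θ (σ 0) < θ (σ 1) ∧ θ (σ 1) < θ (σ 2)} (hUo.mem_nhds h0U)] with θ hθ
    obtain ⟨hθC, hθU⟩ := hθ
    refine congrArg (fun t : ℂ => (1 / 48 : ℂ) * t) (Finset.sum_congr rfl fun ε _ => ?_)
    refine congrArg (fun t : ℂ => ((((if ε 0 then (1 : ℝ) else -1) * (if ε 1 then (1 : ℝ) else -1) * (if ε 2 then (1 : ℝ) else -1) : ℝ)) : ℂ) * t) ?_
    refine Filter.EventuallyEq.iteratedDeriv_eq 3 ?_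
    -- the ray `s ↦ s·v_ε + θ` stays in `U ∩ C_σ` for small `s`
    have hray : ∀ᶠ s : ℝ in 𝓝 (0 : ℝ), s • ![(if ε 0 then (1 : ℝ) else -1) + (if ε 1 then (1 : ℝ) else -1), -(if ε 0 then (1 : ℝ) else -1) + (if ε 2 then (1 : ℝ) else -1), -(if ε 1 then (1 : ℝ) else -1) - (if ε 2 then (1 : ℝ) else -1)] + θ ∈ U ∩ {θ : Fin 3 → ℝ | θ (σ 0) < θ (σ 1) ∧ θ (σ 1) < θ (σ 2)} := by
      have hcont : Continuous fun s : ℝ => s • ![(if ε 0 then (1 : ℝ) else -1) + (if ε 1 then (1 : ℝ) else -1), -(if ε 0 then (1 : ℝ) else -1) + (if ε 2 then (1 : ℝ) else -1), -(if ε 1 then (1 : ℝ) else -1) - (if ε 2 then (1 : ℝ) else -1)] + θ := (continuous_id.smul continuous_const).add continuous_const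
      have hmem : U ∩ {θ : Fin 3 → ℝ | θ (σ 0) < θ (σ 1) ∧ θ (σ 1) < θ (σ 2)} ∈ 𝓝 ((fun s : ℝ => s • ![(if ε 0 then (1 : ℝ) else -1) + (if ε 1 then (1 : ℝ) else -1), -(if ε 0 then (1 : ℝ) else -1) + (if ε 2 then (1 : ℝ) else -1), -(if ε 1 then (1 : ℝ) else -1) - (if ε 2 then (1 : ℝ) else -1)] + θ) 0) := by
        have h0 : (fun s : ℝ => s • ![(if ε 0 then (1 : ℝ) else -1) + (if ε 1 then (1 : ℝ) else -1), -(if ε 0 then (1 : ℝ) else -1) + (if ε 2 then (1 : ℝ) else -1), -(if ε 1 then (1 : ℝ) else -1) - (if ε 2 then (1 : ℝ) else -1)] + θ) 0 = θ := by simp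
        rw [h0]
        exact (hUo.inter (isOpen_chamber σ)).mem_nhds ⟨hθU, hθC⟩
      exact hcont.continuousAt.preimage_mem_nhds hmem
    filter_upwards [hray] with s hs
    rw [hHF _ hs.1 hs.2]
    congr 1
    funext k
    exact (angleChart_mul_exp_ray ζ _ θ s k).symm
  exact (hG.mono_left nhdsWithin_le_nhds).congr' hEq

end OneChamber

/-! ## §4 THE LETTER from per-chamber `C³` corner extensions of `F_Θ = ρ′Δ·Φ_Θ` with the common value `−(c·i)·Θ(ζ•1)` -/

section Letter

variable {L : Type} [Field L] {α : Fin 3 → L} {w : {w : InfinitePlace L // IsComplex w}}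

/-- **(B-2) THE N1 ASSEMBLY SKELETON — `ArchCentralLimitFormulaRankTwo` FROM CHAMBER-WISE `C³` CORNER EXTENSIONS.**  Suppose that for every Borel structure, under the frame guards
(`α_i ≠ 0`, `σ_wα_i` real, one indefinite pair), for every Haar right-invariant `ν` on `G_w = U(σ_w diag α)(ℂ)` there is `c > 0` such that for every ambient smooth `Θ` compactly supported
on `G_w`, every central `ζ ∈ S¹` and EVERY chamber `σ ∈ S₃` there are an open `U ∋ 0` of angle space and `H : ℝ³ → ℂ`, `C³` on `U`, with
`H(θ) = ρ(ζe^{iθ})·′Δ(ζe^{iθ})·∫_{G_w} Θ(g·diag(ζe^{iθ})·g⁻¹) dν` on `U ∩ C_σ` (the letter's `F_Θ` in its own tokens: `ρ = z₀z₂⁻¹`, `′Δ = ∏_{i<j}(1 − z_jz_i⁻¹)`) AND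
`Λ₈^∠[H](0) = (1∕48) Σ_ε s₀s₁s₂ (d∕ds)³|₀ H(s·v_ε) = −(c·i)·Θ(diag(ζ,ζ,ζ))`.  THEN the (L_{U(2,1)}) letter ★ `ArchCentralLimitFormulaRankTwo L α w` holds (§3 per chamber with
`Fz := F_Θ`, then ★ `tendsto_nhdsWithin_injective_of_forall_chamber`; the `def`'s topological instance binders are theorems ★ `locallyCompactSpace_archLocal` ∕ `secondCountableTopology_archLocal`).
This is the shape in which ROAD A ((A1′)(A2″)(A3) value + (A5) jumps + (A6) corner regularity) discharges the registered stub `stub_ArchCentralLimitU21` of «SdArch» ED. 3.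
[cite: Rogawski1990, §8.4 pp. 126–127] [cite: Varadarajan1989, §6.4] -/
theorem ArchCentralLimitFormulaRankTwo.of_chamberExtensions
    (h : ∀ [MeasurableSpace (archLocal L 3 (Matrix.diagonal α) w)] [BorelSpace (archLocal L 3 (Matrix.diagonal α) w)],
      (∀ i, α i ≠ 0) → (∀ i, (w.1.embedding (α i)).im = 0) →
      (∃ i j : Fin 3, (w.1.embedding (α i)).re * (w.1.embedding (α j)).re < 0) →
      ∀ (ν : Measure (archLocal L 3 (Matrix.diagonal α) w)) [ν.IsHaarMeasure] [ν.IsMulRightInvariant],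
      ∃ c : ℝ, 0 < c ∧
        ∀ (Θ : Matrix (Fin 3) (Fin 3) ℂ → ℂ), ContDiff ℝ (⊤ : ℕ∞) Θ →
          HasCompactSupport (fun k : archLocal L 3 (Matrix.diagonal α) w => Θ ((k : GL (Fin 3) ℂ) : Matrix (Fin 3) (Fin 3) ℂ)) →
          ∀ (ζ : Circle) (σ : Equiv.Perm (Fin 3)),
            ∃ (U : Set (Fin 3 → ℝ)) (H : (Fin 3 → ℝ) → ℂ), IsOpen U ∧ (0 : Fin 3 → ℝ) ∈ U ∧ ContDiffOn ℝ 3 H U ∧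
              (∀ θ ∈ U, θ (σ 0) < θ (σ 1) ∧ θ (σ 1) < θ (σ 2) →
                H θ = ((((ζ * Circle.exp (θ 0) : Circle) : ℂ)) * (((ζ * Circle.exp (θ 2) : Circle) : ℂ))⁻¹) * ((1 - (((ζ * Circle.exp (θ 1) : Circle) : ℂ)) * (((ζ * Circle.exp (θ 0) : Circle) : ℂ))⁻¹) * (1 - (((ζ * Circle.exp (θ 2) : Circle) : ℂ)) * (((ζ * Circle.exp (θ 1) : Circle) : ℂ))⁻¹) * (1 - (((ζ * Circle.exp (θ 2) : Circle) : ℂ)) * (((ζ * Circle.exp (θ 0) : Circle) : ℂ))⁻¹)) * (∫ g, Θ (((g * ⟨circleDiagonal 3 (fun k => ζ * Circle.exp (θ k)), circleDiagonal_mem_archLocal_diagonal L 3 α w _⟩ * g⁻¹ : archLocal L 3 (Matrix.diagonal α) w) : GL (Fin 3) ℂ) : Matrix (Fin 3) (Fin 3) ℂ) ∂ν)) ∧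
              (1 / 48 : ℂ) * ∑ ε : Fin 3 → Bool, ((((if ε 0 then (1 : ℝ) else -1) * (if ε 1 then (1 : ℝ) else -1) * (if ε 2 then (1 : ℝ) else -1) : ℝ)) : ℂ) *
          iteratedDeriv 3 (fun s : ℝ => H (s • ![(if ε 0 then (1 : ℝ) else -1) + (if ε 1 then (1 : ℝ) else -1), -(if ε 0 then (1 : ℝ) else -1) + (if ε 2 then (1 : ℝ) else -1), -(if ε 1 then (1 : ℝ) else -1) - (if ε 2 then (1 : ℝ) else -1)])) 0 =
                -((c : ℂ) * Complex.I) * Θ ((circleDiagonal 3 (fun _ => ζ) : GL (Fin 3) ℂ) : Matrix (Fin 3) (Fin 3) ℂ)) :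
    ArchCentralLimitFormulaRankTwo L α w := by
  intro _ _ _ _ hα hreal hind ν _ _
  obtain ⟨c, hc, hΘ⟩ := h hα hreal hind ν
  refine ⟨c, hc, fun Θ hΘd hΘc ζ => ?_⟩
  refine tendsto_nhdsWithin_injective_of_forall_chamber _ ζ _ fun σ => ?_
  obtain ⟨U, H, hUo, h0U, hH, hHF, hval⟩ := hΘ Θ hΘd hΘc ζ σ
  rw [← hval]
  exact tendsto_lambda8_angleChart_nhdsWithin_chamber_of_contDiffOn
    (fun r : Fin 3 → Circle => ((((r 0 : Circle) : ℂ)) * (((r 2 : Circle) : ℂ))⁻¹) * ((1 - (((r 1 : Circle) : ℂ)) * (((r 0 : Circle) : ℂ))⁻¹) * (1 - (((r 2 : Circle) : ℂ)) * (((r 1 : Circle) : ℂ))⁻¹) * (1 - (((r 2 : Circle) : ℂ)) * (((r 0 : Circle) : ℂ))⁻¹)) * (∫ g, Θ (((g * ⟨circleDiagonal 3 r, circleDiagonal_mem_archLocal_diagonal L 3 α w _⟩ * g⁻¹ : archLocal L 3 (Matrix.diagonal α) w) : GL (Fin 3) ℂ) : Matrix (Fin 3) (Fin 3) ℂ) ∂ν))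 ζ σ hUo h0U hH hHF

end Letter

end Literature.NumberTheory.Rogawski1990

end
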